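import Summits.CriticalPhenomena.Ising3DConformalLimit.Theorems.EnergyNotSigmaSquaredGapForcesFarMergingRootFiniteEnergyBox
import Summits.CriticalPhenomena.Ising3DConformalLimit.Theorems.EnergyNotSigmaSquaredGapForcesFarMergingRootOpacityScreen

/-! # The root chain of the screening side: the obstacle `Λ_r ∖ R` screens by at most a bounded factor
(line `screening-form-lemma-a1` of crux `GapForcesFarMerging`, item stmt-CriticalPhenomena-4468;
helper file of stub `stub_rootOpacity`, ROOT FINITE ENERGY, the screening chain at the root)

At `β_c(3)`, hole radius `r ≥ 1`, with the escape ray `R = {(0,1,t) : 0 ≤ t ≤ r}` of the probe point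
`e₂ = (0,1,0)` and the obstacle `T₀ = Λ_r ∖ R`: the screening ratio of `T₀` for the probe pair
`(e₂, dn m)` is bounded below, `⟨σ_{e₂}σ_{dn m}⟩_{Λ_n∖T₀} ≥ η₁(r) ⟨σ_{e₂}σ_{dn m}⟩_{Λ_n}`, uniformly in
`m > r`, `n ≥ 2m` (`screening_root_lower`): a GKS II chain through the shell site `y = (0,1,r+1)`,
positivity along the segment `R ∪ {y}` inside the depleted region, and the finite energy across the hole
`Λ_r` (`finiteEnergy_boxHole`). References: Friedli–Velenik 2017, Thm. 3.20, Exercise 3.12;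
Aizenman–Duminil-Copin 2021, Appendix A (restricted states). -/

noncomputable section

namespace Summit.CriticalPhenomena.Ising3DConformalLimit.EnergyNotSigmaSquaredGapForcesFarMerging

open scoped symmDiff
open MeasureTheory Filter Finset
open Literature.Probability.LatticeModels Literature.Probability.Percolation
open Summit.CriticalPhenomena.Ising3DConformalLimit.Theorems.GapForcesFarMerging.Negative (e₁ e₂ cc2 xR up dn)
open Summit.CriticalPhenomena.Ising3DConformalLimit.GapForcesFarMergingScreening

/-! ### The screening ratio of the root obstacle `T₀ = Λ_r ∖ R` -/

/-- **Root screening floor.** At `β_c(3)`, for `r ≥ 1` there is `η₁(r) > 0` such that for all `m > r`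
and `n ≥ 2m` the screening ratio of the obstacle `T₀ = Λ_r ∖ R`, `R = {(0,1,t) : 0 ≤ t ≤ r}`, for the
probe pair `(e₂, dn m)` is at least `η₁`:
`⟨σ_{e₂}σ_{dn m}⟩_{Λ_n∖T₀} ≥ ⟨σ_{e₂}σ_y⟩_{R∪{y}}⟨σ_yσ_{dn m}⟩_{Λ_n∖Λ_r} ≥ c''·C⁻¹⟨σ_yσ_{e₂}⟩⟨σ_{e₂}σ_{dn m}⟩_{Λ_n}`,
`y = (0,1,r+1)`. [cite: AizenmanDuminilCopinAnnals2021, Appendix A, Lemma A.1] -/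
theorem screening_root_lower (r : ℕ) (hr : 1 ≤ r) :
    ∃ η₁ : ℝ, 0 < η₁ ∧ ∀ m : ℕ, r < m → ∀ n : ℕ, 2 * m ≤ n →
      η₁ ≤ screening n ((box 3 r).filter fun x : Site 3 => ¬(x 0 = 0 ∧ x 1 = 1 ∧ 0 ≤ x 2)) e₂ (dn m) := by
  have hβ : 0 < criticalBeta 3 := criticalBeta_pos_holds (d := 3) (by norm_num)
  obtain ⟨C, hC, hFE⟩ := finiteEnergy_boxHole (d := 3) (by norm_num) hβ r
  -- the escape segment `R ∪ {y}` and its constant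
  set Rseg : Finset (Site 3) := (box 3 (r + 1)).filter fun x : Site 3 => x 0 = 0 ∧ x 1 = 1 ∧ 0 ≤ x 2
    with hRseg
  have hsegmem : ∀ t : ℕ, t ≤ r + 1 → Function.update (e₂ : Site 3) 2 ((0 : ℤ) + t) ∈ Rseg := by
    intro t ht
    obtain ⟨h0, h1, h2⟩ := rayPt_coords ((0 : ℤ) + t)
    rw [hRseg, mem_filter, mem_box_three, h0, h1, h2]
    omega
  have he₂upd : Function.update (e₂ : Site 3) 2 (0 : ℤ) = e₂ :=
    Function.update_eq_self_iff.2 e₂_coords.2.2.symm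
  have he₂seg : (e₂ : Site 3) ∈ Rseg := by
    have h := hsegmem 0 (Nat.zero_le _); rwa [Nat.cast_zero, add_zero, he₂upd] at h
  have hyseg : Function.update (e₂ : Site 3) 2 ((0 : ℤ) + ((r + 1 : ℕ) : ℤ)) ∈ Rseg := hsegmem (r + 1) le_rfl
  have hcseg := isingCorr_axisMove_pos (Λ' := Rseg) hβ (e₂ : Site 3) 2 0 (r + 1) hsegmem
  rw [he₂upd] at hcseg
  obtain ⟨hy0, hy1, hy2⟩ := rayPt_coords ((0 : ℤ) + ((r + 1 : ℕ) : ℤ))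
  set y : Site 3 := Function.update (e₂ : Site 3) 2 ((0 : ℤ) + ((r + 1 : ℕ) : ℤ)) with hy
  set cseg := isingCorr (zdGraph 3) Rseg (criticalBeta 3) 0 .free ({e₂} ∆ {y}) with hcsegdef
  refine ⟨cseg * cseg * C⁻¹, by positivity, fun m hm n hn => ?_⟩
  set T₀ : Finset (Site 3) := (box 3 r).filter fun x : Site 3 => ¬(x 0 = 0 ∧ x 1 = 1 ∧ 0 ≤ x 2) with hT₀
  -- memberships
  obtain ⟨he0, he1, he2⟩ := e₂_coords
  obtain ⟨hd0, hd1, hd2⟩ := dn_coords m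
  have he₂n : (e₂ : Site 3) ∈ box 3 n := by rw [mem_box_three, he0, he1, he2]; omega
  have hdnn : dn m ∈ box 3 n := by rw [mem_box_three, hd0, hd1, hd2]; omega
  have hdnr : dn m ∉ box 3 r := by rw [mem_box_three, hd0]; omega
  have hyshell : y ∈ box 3 (r + 1) \ box 3 r := by
    rw [Finset.mem_sdiff, mem_box_three, mem_box_three, hy0, hy1, hy2]; omega
  have hyn : y ∈ box 3 n := by rw [mem_box_three, hy0, hy1, hy2]; omega
  have hT₀r : T₀ ⊆ box 3 r := Finset.filter_subset _ _
  have hRsegsub : Rseg ⊆ box 3 n \ T₀ := fun x hx => by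
    rw [hRseg, mem_filter, mem_box_three] at hx
    rw [Finset.mem_sdiff, mem_box_three, hT₀, mem_filter]
    push_cast at hx
    exact ⟨by omega, fun h => h.2 hx.2⟩
  have hRsegn : Rseg ⊆ box 3 n := hRsegsub.trans Finset.sdiff_subset
  have hboxsub : box 3 n \ box 3 r ⊆ box 3 n \ T₀ := Finset.sdiff_subset_sdiff le_rfl hT₀r
  have he₂T : (e₂ : Site 3) ∈ box 3 n \ T₀ := hRsegsub he₂seg
  have hyT : y ∈ box 3 n \ T₀ := hRsegsub hyseg
  have hdnT : dn m ∈ box 3 n \ T₀ := hboxsub (Finset.mem_sdiff.2 ⟨hdnn, hdnr⟩)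
  have hne : (e₂ : Site 3) ≠ dn m := fun h => by
    have := congr_fun h 0; rw [he0, hd0] at this; omega
  -- the pieces
  unfold screening boxTwoPoint
  rw [isingTwoPoint_free_eq_isingCorr_symmDiff, isingTwoPoint_free_eq_isingCorr_symmDiff, Finset.sdiff_empty]
  have hD₀ : 0 < isingCorr (zdGraph 3) (box 3 n) (criticalBeta 3) 0 .free ({e₂} ∆ {dn m}) :=
    isingCorr_free_box_pos 3 hβ (pair_symmDiff_subset he₂n hdnn) (by rw [card_pair_symmDiff hne]; exact even_two)
  rw [le_div_iff₀ hD₀]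
  have h1 : cseg ≤ isingCorr (zdGraph 3) (box 3 n \ T₀) (criticalBeta 3) 0 .free ({e₂} ∆ {y}) :=
    isingCorr_free_le_of_subset _ hβ.le le_rfl (pair_symmDiff_subset he₂seg hyseg) hRsegsub
  have h2 : C⁻¹ * isingCorr (zdGraph 3) (box 3 n) (criticalBeta 3) 0 .free ({y} ∆ {dn m}) ≤
      isingCorr (zdGraph 3) (box 3 n \ box 3 r) (criticalBeta 3) 0 .free ({y} ∆ {dn m}) := by
    rw [inv_mul_le_iff₀ hC]
    exact hFE n (by omega) y hyshell (dn m) (Finset.mem_sdiff.2 ⟨hdnn, hdnr⟩)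
  have h3 : isingCorr (zdGraph 3) (box 3 n \ box 3 r) (criticalBeta 3) 0 .free ({y} ∆ {dn m}) ≤
      isingCorr (zdGraph 3) (box 3 n \ T₀) (criticalBeta 3) 0 .free ({y} ∆ {dn m}) :=
    isingCorr_free_le_of_subset _ hβ.le le_rfl
      (pair_symmDiff_subset (Finset.mem_sdiff.2 ⟨hyn, (Finset.mem_sdiff.1 hyshell).2⟩)
        (Finset.mem_sdiff.2 ⟨hdnn, hdnr⟩)) hboxsub
  have h4 : isingCorr (zdGraph 3) (box 3 n) (criticalBeta 3) 0 .free ({y} ∆ {e₂}) *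
      isingCorr (zdGraph 3) (box 3 n) (criticalBeta 3) 0 .free ({e₂} ∆ {dn m}) ≤
      isingCorr (zdGraph 3) (box 3 n) (criticalBeta 3) 0 .free ({y} ∆ {dn m}) :=
    isingCorr_pair_chain _ hyn he₂n hdnn hβ.le
  have h5 : cseg ≤ isingCorr (zdGraph 3) (box 3 n) (criticalBeta 3) 0 .free ({y} ∆ {e₂}) := by
    rw [symmDiff_comm]
    exact h1.trans (isingCorr_free_le_of_subset _ hβ.le le_rfl (pair_symmDiff_subset he₂T hyT)
      Finset.sdiff_subset)
  have h6 : isingCorr (zdGraph 3) (box 3 n \ T₀) (criticalBeta 3) 0 .free ({e₂} ∆ {y}) *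
      isingCorr (zdGraph 3) (box 3 n \ T₀) (criticalBeta 3) 0 .free ({y} ∆ {dn m}) ≤
      isingCorr (zdGraph 3) (box 3 n \ T₀) (criticalBeta 3) 0 .free ({e₂} ∆ {dn m}) :=
    isingCorr_pair_chain _ he₂T hyT hdnT hβ.le
  have hcseg0 : 0 ≤ cseg := hcseg.le
  have hnn1 : 0 ≤ isingCorr (zdGraph 3) (box 3 n \ T₀) (criticalBeta 3) 0 .free ({e₂} ∆ {y}) := hcseg0.trans h1
  calc cseg * cseg * C⁻¹ * isingCorr (zdGraph 3) (box 3 n) (criticalBeta 3) 0 .free ({e₂} ∆ {dn m})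
      = cseg * (C⁻¹ * (cseg * isingCorr (zdGraph 3) (box 3 n) (criticalBeta 3) 0 .free ({e₂} ∆ {dn m}))) := by
        ring
    _ ≤ isingCorr (zdGraph 3) (box 3 n \ T₀) (criticalBeta 3) 0 .free ({e₂} ∆ {y}) *
          (C⁻¹ * isingCorr (zdGraph 3) (box 3 n) (criticalBeta 3) 0 .free ({y} ∆ {dn m})) := by
        refine mul_le_mul h1 (mul_le_mul_of_nonneg_left ?_ (inv_nonneg.2 hC.le)) (by positivity) hnn1
        exact (mul_le_mul_of_nonneg_right h5 hD₀.le).trans h4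
    _ ≤ isingCorr (zdGraph 3) (box 3 n \ T₀) (criticalBeta 3) 0 .free ({e₂} ∆ {y}) *
          isingCorr (zdGraph 3) (box 3 n \ T₀) (criticalBeta 3) 0 .free ({y} ∆ {dn m}) :=
        mul_le_mul_of_nonneg_left (h2.trans h3) hnn1
    _ ≤ isingCorr (zdGraph 3) (box 3 n \ T₀) (criticalBeta 3) 0 .free ({e₂} ∆ {dn m}) := h6


/-- **Root screening floor** (registered form of `screening_root_lower`). [cite: AizenmanDuminilCopinAnnals2021, Appendix A, Lemma A.1] -/
theorem screeningRootLower : ∀ r : ℕ, 1 ≤ r → ∃ η₁ : ℝ, 0 < η₁ ∧ ∀ m : ℕ, r < m → ∀ n : ℕ, 2 * m ≤ n → η₁ ≤ screening n ((box 3 r).filter fun x : Site 3 => ¬(x 0 = 0 ∧ x 1 = 1 ∧ 0 ≤ x 2)) e₂ (dn m) :=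
  screening_root_lower

end Summit.CriticalPhenomena.Ising3DConformalLimit.EnergyNotSigmaSquaredGapForcesFarMerging

end
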